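import Summits.Ventures.LatticeQCDFlow.Scaling.ParallelTemperingAlgorithm
import Summits.Ventures.LatticeQCDFlow.Scaling.SimulatedTemperingExactLadderLaws

/-!
HONEST FRAMING: exact (Metropolis-corrected) sampling algorithms for lattice gauge theory; figures
of merit are autocorrelation/cost numbers at stated couplings and volumes; no continuum-physics
claim.

# ParallelTemperingExactLevelLaw — THE TAGGED REPLICA OF THE REPLICA-EXCHANGE SAMPLER PERFORMS EXACTLY A LAZY
# RANDOM WALK: `ρ_τ(1) = 1 − 6ā_K/(K²(K+2))` PER SWAP ATTEMPT (`1 − 6t·ā_K/(K²(K+2))` IN RANDOM SCAN), AND THE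
# TWO-SIDED LADDER LAW `12e^{−(Δ√(2M)+MΔ²)} ≤ K(K+1)(K+2)(1 − ρ_τ(1)) ≤ 12e^{−mΔ²/4}` (lean-2 GEN-14, ours)

Venture-side (OURS).  Cell `lqcd-flow` (pub-lqcd), unit `pub-lqcd-lean-2-g14`, 2026-08-24.  The replica-exchange
counterpart of `Scaling/SimulatedTemperingExactLevelLaw`: GEN-13's law `ρ_τ(1) ≥ 1 − 6ā_K/(K(K+2))` is a FLOOR
for every kernel whose tag-move probability is `≤ ptSwapRatio` (one swap attempt OR one half-sweep); for the
sampler CONSTRUCTED in GEN-14 (`Scaling/ParallelTemperingAlgorithm`: ONE uniformly chosen adjacent swap attempt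
`S = ptSwapKernel` per step, then / mixed with any tag-preserving exact within-replica dynamics `M`) the general
identity `Var·(1 − ρ(1)) = ½r̄` of `level_lagOneAutocorr_eq` gives the EXACT law with `r̄ = ā_K/K`: one attempt
touches one of the `K` pairs, so per attempt the tag decorrelates `K` times slower than per half-sweep —
consistently with GEN-13's floor once work is counted in swap attempts.

## What is proved (`μ` probability, `X` bounded measurable, `K ≥ 1`; `M` Markov on the tagged space, tag-preserving;
## `ā_K = (2/(K+1))·Σ_{j<K} swapAcc X μ β_j β_{j+1}`)

* `ptTagCoef_eq_zero_of_eq`; **`ptSwapKernel_real_moves_eq`** — `S(z){tag ≠ tag z} = ptSwapRatio(z)/K`;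
  **`pt_moveRate_eq_div`** — `∫ S(z){tag moves} dπ = ā_K/K`.
* **`ptSwapKernel_level_lagOneAutocorr_eq`**, **`ptScan_level_lagOneAutocorr_eq`** (`M ∘ₖ S`),
  **`ptScan_level_lagOneAutocorr_eq_before`** (`S ∘ₖ M`, `M` target-invariant): `ρ_τ(1) = 1 − 6ā_K/(K²(K+2))`;
  **`ptMix_level_lagOneAutocorr_eq`** (`t·S + (1−t)·M`): `ρ_τ(1) = 1 − 6t·ā_K/(K²(K+2))`.
* §4 **`ptScan_one_sub_lagOneAutocorr_ge_optimalLadder`** — with `K* = ⌈(b−a)√(2M)⌉₊` replica gaps,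
  `12·e^{−2}/(((b−a)√(2M)+1)((b−a)√(2M)+2)((b−a)√(2M)+3)) ≤ 1 − ρ_τ(1)` per swap attempt: the
  replica-number-free floor is ATTAINED (order `1/(M(b−a)²)` per sweep).
* §5 `pt_abar_pos`, **`ptScan_level_lagOneAutocorr_lt_one`** — the tag is never frozen at lag one (`ρ_τ(1) < 1`).
* **`ptScan_one_sub_lagOneAutocorr_twoSided`** — uniform ladder `Δ = (b−a)/K`, `m ≤ Var_{μ_u}(X) ≤ M` on `[a,b]`
  (GEN-11's `swapAcc_le_exp_neg_floor` / `swapAcc_ge_exp_neg_ceiling`):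
  `12·e^{−(Δ√(2M) + MΔ²)}/(K(K+1)(K+2)) ≤ 1 − ρ_τ(1) ≤ 12·e^{−mΔ²/4}/(K(K+1)(K+2))`.

Reading (no numerics implied): with `K ≍ (b−a)√M` replicas the tag decorrelates at rate `Θ(1/K³)` per swap
attempt, `Θ(1/K²)` per sweep of `K` attempts — exactly diffusive, no faster and (for this many replicas) no
slower.  NOT CLAIMED: half-sweep kernels (their exact rate is `Θ(ā_K)`·const, not typed); higher lags; any
measured number.  Literature grade (cell rule): KNOWN MECHANISM (random-walk picture of replica exchange,
Katzgraber–Trebst–Huse–Troyer 2006), NEW TYPING (an identity at the kernel level); nothing cited as a fact.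
-/

noncomputable section

open MeasureTheory ProbabilityTheory Set Filter Finset
open Summit.Ventures.LatticeQCDFlow.Scoring
open scoped ENNReal

namespace Summit.Ventures.LatticeQCDFlow.Scaling

/-! ## §1 The exact tag-move rate of the swap kernel -/

section Rate

variable {Ω : Type*} [MeasurableSpace Ω] {X : Ω → ℝ} {μ : Measure Ω} {β : ℕ → ℝ} {K : ℕ}

omit [MeasurableSpace Ω] in
/-- When the tag does not move, its incidence coefficient with the pair is `0`. [ours] -/
theorem ptTagCoef_eq_zero_of_eq (j : Fin K) (τ : Fin (K + 1)) (h : ptPerm K j τ = τ) : ptTagCoef K j τ = 0 := by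
  have h' : ¬ (τ = Fin.castSucc j ∨ τ = Fin.succ j) := fun hh => ((ptPerm_ne_self_iff j τ).2 hh) h
  push Not at h'
  unfold ptTagCoef
  rw [if_neg (Ne.symm h'.1), if_neg (Ne.symm h'.2), add_zero]

/-- **THE SWAP KERNEL MOVES THE TAG WITH PROBABILITY EXACTLY `ptSwapRatio/K`.** [ours] -/
theorem ptSwapKernel_real_moves_eq (hXm : Measurable X) (z : Fin (K + 1) × (Fin (K + 1) → Ω)) :
    (ptSwapKernel hXm β K z).real {y | ((y.1 : Fin (K + 1)) : ℕ) ≠ ((z.1 : Fin (K + 1)) : ℕ)} =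
      ptSwapRatio X β K z / K := by
  set S : Set (Fin (K + 1) × (Fin (K + 1) → Ω)) := {y | ((y.1 : Fin (K + 1)) : ℕ) ≠ ((z.1 : Fin (K + 1)) : ℕ)}
    with hS_def
  have e : S = (fun y : Fin (K + 1) × (Fin (K + 1) → Ω) => ((y.1 : Fin (K + 1)) : ℕ)) ⁻¹'
      {n : ℕ | n ≠ ((z.1 : Fin (K + 1)) : ℕ)} := by
    ext y; simp [hS_def]
  have hS : MeasurableSet S := by rw [e]; exact measurable_ptLevel MeasurableSet.of_discrete
  rw [measureReal_def, ptSwapKernel_apply' hXm z hS]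
  have hz : z ∉ S := by simp [hS_def]
  simp only [Set.indicator_of_notMem hz, mul_zero, add_zero]
  have hterm : ∀ j : Fin K, ENNReal.ofReal (ptPairRatio X β K j z.2) * S.indicator 1 (ptSwapMap K j z) =
      ENNReal.ofReal (ptTagCoef K j z.1 * ptPairRatio X β K j z.2) := by
    intro j
    by_cases hne : ptPerm K j z.1 ≠ z.1
    · have hmem : ptSwapMap K j z ∈ S := by
        rw [hS_def, Set.mem_setOf_eq]
        exact fun h => hne (Fin.ext h)
      rw [Set.indicator_of_mem hmem, Pi.one_apply, mul_one, ptTagCoef_eq_one_of_ne j z.1 hne, one_mul]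
    · push Not at hne
      have hnot : ptSwapMap K j z ∉ S := by
        rw [hS_def, Set.mem_setOf_eq, not_not]
        show ((ptPerm K j z.1 : Fin (K + 1)) : ℕ) = ((z.1 : Fin (K + 1)) : ℕ)
        rw [hne]
      rw [Set.indicator_of_notMem hnot, mul_zero, ptTagCoef_eq_zero_of_eq j z.1 hne, zero_mul, ENNReal.ofReal_zero]
  simp only [hterm]
  rw [← ENNReal.ofReal_sum_of_nonneg fun j _ => mul_nonneg (ptTagCoef_mem j z.1).1 (ptPairRatio_mem j z.2).1,
    ENNReal.toReal_mul, ENNReal.toReal_inv, ENNReal.toReal_natCast,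
    ENNReal.toReal_ofReal (Finset.sum_nonneg fun j _ => mul_nonneg (ptTagCoef_mem j z.1).1 (ptPairRatio_mem j z.2).1)]
  rw [ptSwapRatio, inv_mul_eq_div]

variable [IsProbabilityMeasure μ]

/-- **THE STATIONARY TAG-MOVE RATE OF THE SWAP KERNEL IS `ā_K/K`**:
`∫ S(z){tag moves} dπ = (1/K)·(2/(K+1))·Σ_j swapAcc X μ β_j β_{j+1}`. [ours] -/
theorem pt_moveRate_eq_div (hXm : Measurable X) (hXb : ∃ C, ∀ x, |X x| ≤ C) :
    ∫ z, (ptSwapKernel hXm β K z).real {y | ((y.1 : Fin (K + 1)) : ℕ) ≠ ((z.1 : Fin (K + 1)) : ℕ)}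
        ∂(ptTaggedTarget X μ β K) =
      1 / K * (2 / (K + 1) * ∑ j : Fin K, swapAcc X μ (β (j : ℕ)) (β ((j : ℕ) + 1))) := by
  simp only [ptSwapKernel_real_moves_eq hXm]
  have e : (fun z : Fin (K + 1) × (Fin (K + 1) → Ω) => ptSwapRatio X β K z / K) =
      fun z => 1 / K * ptSwapRatio X β K z := by
    funext z; ring
  rw [e, integral_const_mul, pt_moveRate_eq hXm hXb]

end Rate

/-! ## §2 The exact law for the sampler -/

section Sampler

variable {Ω : Type*} [MeasurableSpace Ω] {X : Ω → ℝ} {μ : Measure Ω} [IsProbabilityMeasure μ] {β : ℕ → ℝ} {K : ℕ}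

/-- **EXACT TAG LAW FOR THE SWAP KERNEL ALONE**: `ρ_τ(1) = 1 − 6ā_K/(K²(K+2))` (`K ≥ 1`). [ours] -/
theorem ptSwapKernel_level_lagOneAutocorr_eq (hXm : Measurable X) (hXb : ∃ C, ∀ x, |X x| ≤ C) (hK : 1 ≤ K) :
    (autocov (ptSwapKernel hXm β K) (ptTaggedTarget X μ β K) (fun z => (((z.1 : Fin (K + 1)) : ℕ) : ℝ)) 1 -
        ((K : ℝ) / 2) ^ 2) / (K * (K + 2) / 12) =
      1 - 6 * (2 / (K + 1) * ∑ j : Fin K, swapAcc X μ (β (j : ℕ)) (β ((j : ℕ) + 1))) / (K * (K * (K + 2))) := by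
  haveI := isProbabilityMeasure_ptTaggedTarget (μ := μ) (β := β) (K := K) hXm hXb
  haveI : NeZero K := ⟨by omega⟩
  rw [level_lagOneAutocorr_eq (lev := fun z : Fin (K + 1) × (Fin (K + 1) → Ω) => ((z.1 : Fin (K + 1)) : ℕ))
    (invariant_ptSwapKernel hXm hXb) measurable_ptLevel (fun z => Nat.le_of_lt_succ z.1.isLt) hK
    (fun k hk => ptTaggedTarget_real_level hXm hXb k hk) (ptSwapKernel_nearestNeighbour hXm),
    pt_moveRate_eq_div hXm hXb]
  have hK0 : (0 : ℝ) < K := by exact_mod_cast hK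
  field_simp

/-- **EXACT TAG LAW FOR THE SAMPLER `M ∘ₖ S`** (`M` any tag-preserving Markov kernel — exact within-replica dynamics
need not even be target-invariant for this identity; `K ≥ 1`): `ρ_τ(1) = 1 − 6ā_K/(K²(K+2))`. [ours] -/
theorem ptScan_level_lagOneAutocorr_eq (hXm : Measurable X) (hXb : ∃ C, ∀ x, |X x| ≤ C) (hK : 1 ≤ K)
    (M : Kernel (Fin (K + 1) × (Fin (K + 1) → Ω)) (Fin (K + 1) × (Fin (K + 1) → Ω))) [IsMarkovKernel M]
    (hM : ∀ y, M y {y' | ((y'.1 : Fin (K + 1)) : ℕ) ≠ ((y.1 : Fin (K + 1)) : ℕ)} = 0) :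
    (autocov (M ∘ₖ ptSwapKernel hXm β K) (ptTaggedTarget X μ β K) (fun z => (((z.1 : Fin (K + 1)) : ℕ) : ℝ)) 1 -
        ((K : ℝ) / 2) ^ 2) / (K * (K + 2) / 12) =
      1 - 6 * (2 / (K + 1) * ∑ j : Fin K, swapAcc X μ (β (j : ℕ)) (β ((j : ℕ) + 1))) / (K * (K * (K + 2))) := by
  haveI : NeZero K := ⟨by omega⟩
  rw [autocov_comp_levelPreserving_after (lev := fun z : Fin (K + 1) × (Fin (K + 1) → Ω) => ((z.1 : Fin (K + 1)) : ℕ))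
    (f := fun z : Fin (K + 1) × (Fin (K + 1) → Ω) => (((z.1 : Fin (K + 1)) : ℕ) : ℝ))
    (L := ptSwapKernel hXm β K) hM (measurable_from_nat.comp measurable_ptLevel)
    (abs_level_le fun z : Fin (K + 1) × (Fin (K + 1) → Ω) => Nat.le_of_lt_succ z.1.isLt) (fun y y' h => by simp only [h])]
  exact ptSwapKernel_level_lagOneAutocorr_eq hXm hXb hK

/-- **EXACT TAG LAW FOR `S ∘ₖ M`** ("update the replicas, then attempt a swap"; `M` tag-preserving and
target-invariant, `K ≥ 1`): `ρ_τ(1) = 1 − 6ā_K/(K²(K+2))`. [ours] -/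
theorem ptScan_level_lagOneAutocorr_eq_before (hXm : Measurable X) (hXb : ∃ C, ∀ x, |X x| ≤ C) (hK : 1 ≤ K)
    (M : Kernel (Fin (K + 1) × (Fin (K + 1) → Ω)) (Fin (K + 1) × (Fin (K + 1) → Ω))) [IsMarkovKernel M]
    (hMinv : Kernel.Invariant M (ptTaggedTarget X μ β K))
    (hM : ∀ y, M y {y' | ((y'.1 : Fin (K + 1)) : ℕ) ≠ ((y.1 : Fin (K + 1)) : ℕ)} = 0) :
    (autocov (ptSwapKernel hXm β K ∘ₖ M) (ptTaggedTarget X μ β K) (fun z => (((z.1 : Fin (K + 1)) : ℕ) : ℝ)) 1 -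
        ((K : ℝ) / 2) ^ 2) / (K * (K + 2) / 12) =
      1 - 6 * (2 / (K + 1) * ∑ j : Fin K, swapAcc X μ (β (j : ℕ)) (β ((j : ℕ) + 1))) / (K * (K * (K + 2))) := by
  haveI := isProbabilityMeasure_ptTaggedTarget (μ := μ) (β := β) (K := K) hXm hXb
  haveI : NeZero K := ⟨by omega⟩
  rw [autocov_comp_levelPreserving_before (lev := fun z : Fin (K + 1) × (Fin (K + 1) → Ω) => ((z.1 : Fin (K + 1)) : ℕ))
    (f := fun z : Fin (K + 1) × (Fin (K + 1) → Ω) => (((z.1 : Fin (K + 1)) : ℕ) : ℝ))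
    (L := ptSwapKernel hXm β K) hMinv hM (measurable_from_nat.comp measurable_ptLevel)
    (abs_level_le fun z : Fin (K + 1) × (Fin (K + 1) → Ω) => Nat.le_of_lt_succ z.1.isLt) (fun y y' h => by simp only [h])]
  exact ptSwapKernel_level_lagOneAutocorr_eq hXm hXb hK

/-- **EXACT TAG LAW FOR THE RANDOM-SCAN SAMPLER `t·S + (1−t)·M`** (`M` tag-preserving, target-invariant Markov,
`K ≥ 1`): `ρ_τ(1) = 1 − 6t·ā_K/(K²(K+2))`. [ours] -/
theorem ptMix_level_lagOneAutocorr_eq (hXm : Measurable X) (hXb : ∃ C, ∀ x, |X x| ≤ C) (hK : 1 ≤ K)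
    (t : unitInterval) (M : Kernel (Fin (K + 1) × (Fin (K + 1) → Ω)) (Fin (K + 1) × (Fin (K + 1) → Ω)))
    [IsMarkovKernel M] (hMinv : Kernel.Invariant M (ptTaggedTarget X μ β K))
    (hM : ∀ y, M y {y' | ((y'.1 : Fin (K + 1)) : ℕ) ≠ ((y.1 : Fin (K + 1)) : ℕ)} = 0) :
    (autocov (mixtureKernel t (ptSwapKernel hXm β K) M) (ptTaggedTarget X μ β K)
          (fun z => (((z.1 : Fin (K + 1)) : ℕ) : ℝ)) 1 - ((K : ℝ) / 2) ^ 2) / (K * (K + 2) / 12) =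
      1 - 6 * (t : ℝ) * (2 / (K + 1) * ∑ j : Fin K, swapAcc X μ (β (j : ℕ)) (β ((j : ℕ) + 1))) /
        (K * (K * (K + 2))) := by
  haveI := isProbabilityMeasure_ptTaggedTarget (μ := μ) (β := β) (K := K) hXm hXb
  haveI : NeZero K := ⟨by omega⟩
  rw [level_lagOneAutocorr_eq (lev := fun z : Fin (K + 1) × (Fin (K + 1) → Ω) => ((z.1 : Fin (K + 1)) : ℕ))
    (ptMix_invariant hXm hXb t M hMinv) measurable_ptLevel (fun z => Nat.le_of_lt_succ z.1.isLt) hK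
    (fun k hk => ptTaggedTarget_real_level hXm hXb k hk) (ptMix_nearestNeighbour hXm t M hM)]
  have hrate : ∀ z : Fin (K + 1) × (Fin (K + 1) → Ω), (mixtureKernel t (ptSwapKernel hXm β K) M z).real
      {y | ((y.1 : Fin (K + 1)) : ℕ) ≠ ((z.1 : Fin (K + 1)) : ℕ)} =
      (t : ℝ) * (ptSwapKernel hXm β K z).real {y | ((y.1 : Fin (K + 1)) : ℕ) ≠ ((z.1 : Fin (K + 1)) : ℕ)} := by
    intro z
    rw [mixtureKernel_real, measureReal_def (μ := M z), hM z, ENNReal.toReal_zero, mul_zero, add_zero]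
  simp only [hrate]
  rw [integral_const_mul, pt_moveRate_eq_div hXm hXb]
  have hK0 : (0 : ℝ) < K := by exact_mod_cast hK
  field_simp

end Sampler

/-! ## §3 The two-sided ladder law -/

section Ladder

variable {Ω : Type*} [MeasurableSpace Ω] {X : Ω → ℝ} {μ : Measure Ω} [IsProbabilityMeasure μ] {K : ℕ}

/-- **THE TWO-SIDED LADDER LAW FOR THE REPLICA-EXCHANGE SAMPLER.**  Uniform ladder `β_k = a + kΔ`,
`Δ = (b−a)/K`, `a < b`, `K ≥ 1`, variance floor and ceiling `m ≤ Var_{μ_u}(X) ≤ M` on `[a, b]`, `Mk` any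
tag-preserving Markov kernel.  Then the sampler `Mk ∘ₖ ptSwapKernel` satisfies
`12·e^{−(Δ√(2M) + MΔ²)}/(K(K+1)(K+2)) ≤ 1 − ρ_τ(1) ≤ 12·e^{−mΔ²/4}/(K(K+1)(K+2))`. [ours] -/
theorem ptScan_one_sub_lagOneAutocorr_twoSided (hXm : Measurable X) (hXb : ∃ C, ∀ x, |X x| ≤ C) {a b m M : ℝ}
    (hab : a < b) (hm : ∀ u ∈ Icc a b, m ≤ variance X (μ.tilted fun x => u * X x))
    (hM : ∀ u ∈ Icc a b, variance X (μ.tilted fun x => u * X x) ≤ M) (hK : 1 ≤ K)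
    (Mk : Kernel (Fin (K + 1) × (Fin (K + 1) → Ω)) (Fin (K + 1) × (Fin (K + 1) → Ω))) [IsMarkovKernel Mk]
    (hMk : ∀ y, Mk y {y' | ((y'.1 : Fin (K + 1)) : ℕ) ≠ ((y.1 : Fin (K + 1)) : ℕ)} = 0) :
    12 * Real.exp (-((b - a) / K * Real.sqrt (2 * M) + M * ((b - a) / K) ^ 2)) / (K * (K + 1) * (K + 2)) ≤
      1 - (autocov (Mk ∘ₖ ptSwapKernel hXm (fun k => a + k * ((b - a) / K)) K)
          (ptTaggedTarget X μ (fun k => a + k * ((b - a) / K)) K)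
          (fun z => (((z.1 : Fin (K + 1)) : ℕ) : ℝ)) 1 - ((K : ℝ) / 2) ^ 2) / (K * (K + 2) / 12) ∧
    1 - (autocov (Mk ∘ₖ ptSwapKernel hXm (fun k => a + k * ((b - a) / K)) K)
          (ptTaggedTarget X μ (fun k => a + k * ((b - a) / K)) K)
          (fun z => (((z.1 : Fin (K + 1)) : ℕ) : ℝ)) 1 - ((K : ℝ) / 2) ^ 2) / (K * (K + 2) / 12) ≤
      12 * Real.exp (-(m * (b - a) ^ 2 / (4 * K ^ 2))) / (K * (K + 1) * (K + 2)) := by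
  rw [ptScan_level_lagOneAutocorr_eq (β := fun k => a + k * ((b - a) / K)) hXm hXb hK Mk hMk]
  have hKr : (1 : ℝ) ≤ K := by exact_mod_cast hK
  have hK0 : (0 : ℝ) < K := by linarith
  have hδ : 0 ≤ (b - a) / K := div_nonneg (sub_nonneg.2 hab.le) hK0.le
  set S : ℝ := ∑ j : Fin K, swapAcc X μ (a + (j : ℕ) * ((b - a) / K)) (a + (((j : ℕ) + 1 : ℕ) : ℝ) * ((b - a) / K))
    with hS_def
  have hup : 2 / (K + 1) * S ≤ 2 * K / (K + 1) * Real.exp (-(m * (b - a) ^ 2 / (4 * K ^ 2))) :=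
    pt_moveRate_le_ladder (μ := μ) hXm hXb hab.le hK hm
  have hlow : (K : ℝ) * Real.exp (-((b - a) / K * Real.sqrt (2 * M) + M * ((b - a) / K) ^ 2)) ≤ S := by
    have hstep : ∀ j : Fin K, Real.exp (-((b - a) / K * Real.sqrt (2 * M) + M * ((b - a) / K) ^ 2)) ≤
        swapAcc X μ (a + (j : ℕ) * ((b - a) / K)) (a + (((j : ℕ) + 1 : ℕ) : ℝ) * ((b - a) / K)) := by
      intro j
      have hjK : ((j : ℕ) : ℝ) + 1 ≤ K := by exact_mod_cast Nat.succ_le_of_lt j.isLt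
      have hs : a ≤ a + (j : ℕ) * ((b - a) / K) := le_add_of_nonneg_right (mul_nonneg (Nat.cast_nonneg _) hδ)
      have hst : a + (j : ℕ) * ((b - a) / K) ≤ a + (((j : ℕ) + 1 : ℕ) : ℝ) * ((b - a) / K) := by
        push_cast; nlinarith
      have ht : a + (((j : ℕ) + 1 : ℕ) : ℝ) * ((b - a) / K) ≤ b := by
        push_cast
        have : (((j : ℕ) : ℝ) + 1) * ((b - a) / K) ≤ K * ((b - a) / K) := mul_le_mul_of_nonneg_right hjK hδ
        rw [mul_div_cancel₀ _ hK0.ne'] at this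
        linarith
      have h := swapAcc_ge_exp_neg_ceiling hXm hXb hst fun u hu => hM u ⟨hs.trans hu.1, hu.2.trans ht⟩
      have e : a + (((j : ℕ) + 1 : ℕ) : ℝ) * ((b - a) / K) - (a + (j : ℕ) * ((b - a) / K)) = (b - a) / K := by
        push_cast; ring
      rw [e] at h
      exact h
    calc (K : ℝ) * Real.exp (-((b - a) / K * Real.sqrt (2 * M) + M * ((b - a) / K) ^ 2))
        = ∑ _j : Fin K, Real.exp (-((b - a) / K * Real.sqrt (2 * M) + M * ((b - a) / K) ^ 2)) := by
          rw [Finset.sum_const, Finset.card_univ, Fintype.card_fin, nsmul_eq_mul]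
      _ ≤ S := Finset.sum_le_sum fun j _ => hstep j
  have hK1 : (0 : ℝ) < K + 1 := by linarith
  have hK3 : (0 : ℝ) < K * (K + 1) * (K + 2) := by positivity
  constructor
  · have e : 1 - (1 - 6 * (2 / (K + 1) * S) / (K * (K * (K + 2)))) = 12 * S / (K * (K + 1) * (K * (K + 2))) := by
      field_simp
      ring
    rw [e, div_le_div_iff₀ hK3 (by positivity)]
    have h1 : 12 * Real.exp (-((b - a) / K * Real.sqrt (2 * M) + M * ((b - a) / K) ^ 2)) * (K * (K + 1) * (K * (K + 2)))
        = (12 * (K * Real.exp (-((b - a) / K * Real.sqrt (2 * M) + M * ((b - a) / K) ^ 2)))) *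
          (K * (K + 1) * (K + 2)) := by
      ring
    rw [h1]
    exact mul_le_mul_of_nonneg_right (by linarith) hK3.le
  · have e : 1 - (1 - 6 * (2 / (K + 1) * S) / (K * (K * (K + 2)))) = 6 * (2 / (K + 1) * S) / (K * (K * (K + 2))) := by
      ring
    rw [e]
    calc 6 * (2 / (K + 1) * S) / (K * (K * (K + 2)))
        ≤ 6 * (2 * K / (K + 1) * Real.exp (-(m * (b - a) ^ 2 / (4 * K ^ 2)))) / (K * (K * (K + 2))) := by
          gcongr
      _ = 12 * Real.exp (-(m * (b - a) ^ 2 / (4 * K ^ 2))) / (K * (K + 1) * (K + 2)) := by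
          field_simp
          ring

end Ladder

/-! ## §4 The replica-number-free floor is attained -/

section Optimal

variable {Ω : Type*} [MeasurableSpace Ω] {X : Ω → ℝ} {μ : Measure Ω} [IsProbabilityMeasure μ]

/-- **THE REPLICA-NUMBER-FREE RATE IS ATTAINED WITH `K* = ⌈(b−a)√(2M)⌉` REPLICA GAPS** (`μ` probability, `X`
bounded measurable, `a < b`, `0 < M`, `Var_{μ_u}(X) ≤ M` on `[a, b]`, `Mk` any tag-preserving Markov kernel): for
the replica-exchange sampler `Mk ∘ₖ ptSwapKernel` on the uniform ladder with `K*` steps,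
`12·e^{−2}/(((b−a)√(2M)+1)·((b−a)√(2M)+2)·((b−a)√(2M)+3)) ≤ 1 − ρ_τ(1)`. [ours] -/
theorem ptScan_one_sub_lagOneAutocorr_ge_optimalLadder (hXm : Measurable X) (hXb : ∃ C, ∀ x, |X x| ≤ C)
    {a b M : ℝ} (hab : a < b) (hM0 : 0 < M) (hM : ∀ u ∈ Icc a b, variance X (μ.tilted fun x => u * X x) ≤ M)
    (Mk : Kernel (Fin (⌈(b - a) * Real.sqrt (2 * M)⌉₊ + 1) × (Fin (⌈(b - a) * Real.sqrt (2 * M)⌉₊ + 1) → Ω))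
      (Fin (⌈(b - a) * Real.sqrt (2 * M)⌉₊ + 1) × (Fin (⌈(b - a) * Real.sqrt (2 * M)⌉₊ + 1) → Ω)))
    [IsMarkovKernel Mk]
    (hMk : ∀ y, Mk y {y' | ((y'.1 : Fin (⌈(b - a) * Real.sqrt (2 * M)⌉₊ + 1)) : ℕ) ≠
      ((y.1 : Fin (⌈(b - a) * Real.sqrt (2 * M)⌉₊ + 1)) : ℕ)} = 0) :
    12 * Real.exp (-2) /
        (((b - a) * Real.sqrt (2 * M) + 1) * ((b - a) * Real.sqrt (2 * M) + 2) * ((b - a) * Real.sqrt (2 * M) + 3)) ≤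
      1 - (autocov (Mk ∘ₖ ptSwapKernel hXm
              (fun k => a + k * ((b - a) / ⌈(b - a) * Real.sqrt (2 * M)⌉₊)) ⌈(b - a) * Real.sqrt (2 * M)⌉₊)
          (ptTaggedTarget X μ (fun k => a + k * ((b - a) / ⌈(b - a) * Real.sqrt (2 * M)⌉₊))
            ⌈(b - a) * Real.sqrt (2 * M)⌉₊)
          (fun z => (((z.1 : Fin (⌈(b - a) * Real.sqrt (2 * M)⌉₊ + 1)) : ℕ) : ℝ)) 1 -
            ((⌈(b - a) * Real.sqrt (2 * M)⌉₊ : ℝ) / 2) ^ 2) /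
        (⌈(b - a) * Real.sqrt (2 * M)⌉₊ * (⌈(b - a) * Real.sqrt (2 * M)⌉₊ + 2) / 12) := by
  have hM2 : 0 < 2 * M := by linarith
  have hK1 : 1 ≤ ⌈(b - a) * Real.sqrt (2 * M)⌉₊ := natCeil_window_pos hab hM2
  have hm : ∀ u ∈ Icc a b, (0 : ℝ) ≤ variance X (μ.tilted fun x => u * X x) := fun u _ => variance_nonneg _ _
  have h := (ptScan_one_sub_lagOneAutocorr_twoSided (μ := μ) hXm hXb hab hm hM hK1 Mk hMk).1
  refine le_trans ?_ h
  have hs : 0 ≤ Real.sqrt (2 * M) := Real.sqrt_nonneg _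
  have hδ1 : (b - a) / ⌈(b - a) * Real.sqrt (2 * M)⌉₊ * Real.sqrt (2 * M) ≤ 1 :=
    window_div_ceil_mul_sqrt_le_one hab hM2
  have hδ0 : 0 ≤ (b - a) / ⌈(b - a) * Real.sqrt (2 * M)⌉₊ * Real.sqrt (2 * M) :=
    mul_nonneg (div_nonneg (sub_nonneg.2 hab.le) (Nat.cast_nonneg _)) hs
  have hexp : Real.exp (-2) ≤ Real.exp (-((b - a) / ⌈(b - a) * Real.sqrt (2 * M)⌉₊ * Real.sqrt (2 * M) +
      M * ((b - a) / ⌈(b - a) * Real.sqrt (2 * M)⌉₊) ^ 2)) := by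
    apply Real.exp_le_exp.2
    have e : M * ((b - a) / ⌈(b - a) * Real.sqrt (2 * M)⌉₊) ^ 2 =
        ((b - a) / ⌈(b - a) * Real.sqrt (2 * M)⌉₊ * Real.sqrt (2 * M)) ^ 2 / 2 := by
      rw [mul_pow, Real.sq_sqrt hM2.le]; ring
    rw [e]
    nlinarith
  have hKle : ((⌈(b - a) * Real.sqrt (2 * M)⌉₊ : ℕ) : ℝ) ≤ (b - a) * Real.sqrt (2 * M) + 1 :=
    (Nat.ceil_lt_add_one (mul_nonneg (sub_nonneg.2 hab.le) hs)).le
  have hKge : (1 : ℝ) ≤ ((⌈(b - a) * Real.sqrt (2 * M)⌉₊ : ℕ) : ℝ) := by exact_mod_cast hK1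
  have hKpos : (0 : ℝ) < ((⌈(b - a) * Real.sqrt (2 * M)⌉₊ : ℕ) : ℝ) *
      (((⌈(b - a) * Real.sqrt (2 * M)⌉₊ : ℕ) : ℝ) + 1) * (((⌈(b - a) * Real.sqrt (2 * M)⌉₊ : ℕ) : ℝ) + 2) := by
    positivity
  have hw : 0 ≤ (b - a) * Real.sqrt (2 * M) := mul_nonneg (sub_nonneg.2 hab.le) hs
  have hden : ((⌈(b - a) * Real.sqrt (2 * M)⌉₊ : ℕ) : ℝ) *
      (((⌈(b - a) * Real.sqrt (2 * M)⌉₊ : ℕ) : ℝ) + 1) * (((⌈(b - a) * Real.sqrt (2 * M)⌉₊ : ℕ) : ℝ) + 2) ≤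
      ((b - a) * Real.sqrt (2 * M) + 1) * ((b - a) * Real.sqrt (2 * M) + 2) * ((b - a) * Real.sqrt (2 * M) + 3) := by
    have h1 : ((⌈(b - a) * Real.sqrt (2 * M)⌉₊ : ℕ) : ℝ) + 1 ≤ (b - a) * Real.sqrt (2 * M) + 2 := by linarith
    have h2 : ((⌈(b - a) * Real.sqrt (2 * M)⌉₊ : ℕ) : ℝ) + 2 ≤ (b - a) * Real.sqrt (2 * M) + 3 := by linarith
    have h0 : (0 : ℝ) ≤ ((⌈(b - a) * Real.sqrt (2 * M)⌉₊ : ℕ) : ℝ) := Nat.cast_nonneg _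
    exact mul_le_mul (mul_le_mul hKle h1 (by linarith) (by linarith)) h2 (by linarith) (by positivity)
  calc 12 * Real.exp (-2) /
        (((b - a) * Real.sqrt (2 * M) + 1) * ((b - a) * Real.sqrt (2 * M) + 2) * ((b - a) * Real.sqrt (2 * M) + 3))
      ≤ 12 * Real.exp (-2) / (((⌈(b - a) * Real.sqrt (2 * M)⌉₊ : ℕ) : ℝ) *
          (((⌈(b - a) * Real.sqrt (2 * M)⌉₊ : ℕ) : ℝ) + 1) * (((⌈(b - a) * Real.sqrt (2 * M)⌉₊ : ℕ) : ℝ) + 2)) :=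
        div_le_div_of_nonneg_left (by positivity) hKpos hden
    _ ≤ 12 * Real.exp (-((b - a) / ⌈(b - a) * Real.sqrt (2 * M)⌉₊ * Real.sqrt (2 * M) +
          M * ((b - a) / ⌈(b - a) * Real.sqrt (2 * M)⌉₊) ^ 2)) / (((⌈(b - a) * Real.sqrt (2 * M)⌉₊ : ℕ) : ℝ) *
          (((⌈(b - a) * Real.sqrt (2 * M)⌉₊ : ℕ) : ℝ) + 1) * (((⌈(b - a) * Real.sqrt (2 * M)⌉₊ : ℕ) : ℝ) + 2)) := by
        gcongr

end Optimal

/-! ## §5 The tag is never frozen: `ā_K > 0`, so `ρ_τ(1) < 1` -/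

section Positive

variable {Ω : Type*} [MeasurableSpace Ω] {X : Ω → ℝ} {μ : Measure Ω} [IsProbabilityMeasure μ] {β : ℕ → ℝ} {K : ℕ}

/-- **`ā_K > 0` for replica exchange** (`K ≥ 1`): every swap acceptance is positive (GEN-11's
`swapAcc_ge_exp_neg`). [ours] -/
theorem pt_abar_pos (hXm : Measurable X) (hXb : ∃ C, ∀ x, |X x| ≤ C) (hK : 1 ≤ K) :
    0 < 2 / (K + 1) * ∑ j : Fin K, swapAcc X μ (β (j : ℕ)) (β ((j : ℕ) + 1)) := by
  haveI : Nonempty (Fin K) := ⟨⟨0, by omega⟩⟩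
  refine mul_pos (by positivity) (Finset.sum_pos (fun j _ => ?_) Finset.univ_nonempty)
  exact lt_of_lt_of_le (Real.exp_pos _) (swapAcc_ge_exp_neg hXm hXb _ _)

/-- **THE TAG IS NEVER FROZEN AT LAG ONE**: `ρ_τ(1) < 1` for `M ∘ₖ ptSwapKernel` (`K ≥ 1`; any tag-preserving
Markov `M`) — the `ρ(1) < 1` proviso of the `τ_int` floors holds for the constructed sampler. [ours] -/
theorem ptScan_level_lagOneAutocorr_lt_one (hXm : Measurable X) (hXb : ∃ C, ∀ x, |X x| ≤ C) (hK : 1 ≤ K)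
    (M : Kernel (Fin (K + 1) × (Fin (K + 1) → Ω)) (Fin (K + 1) × (Fin (K + 1) → Ω))) [IsMarkovKernel M]
    (hM : ∀ y, M y {y' | ((y'.1 : Fin (K + 1)) : ℕ) ≠ ((y.1 : Fin (K + 1)) : ℕ)} = 0) :
    (autocov (M ∘ₖ ptSwapKernel hXm β K) (ptTaggedTarget X μ β K) (fun z => (((z.1 : Fin (K + 1)) : ℕ) : ℝ)) 1 -
        ((K : ℝ) / 2) ^ 2) / (K * (K + 2) / 12) < 1 := by
  rw [ptScan_level_lagOneAutocorr_eq hXm hXb hK M hM]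
  have hK0 : (0 : ℝ) < K := by exact_mod_cast hK
  have h := pt_abar_pos (μ := μ) (β := β) hXm hXb hK
  have : 0 < 6 * (2 / (K + 1) * ∑ j : Fin K, swapAcc X μ (β (j : ℕ)) (β ((j : ℕ) + 1))) / (K * (K * (K + 2))) := by
    positivity
  linarith

end Positive

end Summit.Ventures.LatticeQCDFlow.Scaling

end
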